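/-
Copyright (c) 2026 the pub-hodgecm-mathlib formalisation cell (harness21).  Prover seat hodgecm-mathlib-LH10-p01 (g12): road M6 → F5 → dyadic chain of `stub_DyUnramCore` (D-UNR),
brick (L2-1)-dy «BOUNDARY VALUES, 2-FREE» part 2∕4 — RIGID-2 (boundary rigidity at level two) without `v 2 = 1`; 2026-09-03.
-/
import Literature.NumberTheory.Automorphic.UnitaryThreeBoundaryRigidityLevelTwo          -- ★ RIGID-2 (F0P3-p03): §1∕§2∕§4 (2-free: residual types, the near-Heisenberg bridge, the unit-factor adapters) and the `v 2 = 1` §3 originals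
import Literature.NumberTheory.Automorphic.UnitaryThreeLevelTwoHeisenbergClassesOfTrace   -- ★-to-be (this seat, part 1∕4): the level-two Heisenberg classes with `h2` deleted
import HarnessLib

/-!
# Boundary rigidity at level two for the hyperspecial unitary group in three variables — EVERY residue characteristic (RIGID-2 without `v 2 = 1`)

Topic `NumberTheory/Automorphic`; namespace `Literature.NumberTheory.Automorphic.UnitaryGroup`.  THEOREMS ONLY (no definition, no instance, no notation, no named fact, no `sorry`);
kernel lane `--supports stmt-HodgeConjecture-24833`.  Cell `pub/hodgecm-mathlib` (D-0151), crux H413 = `stmt-HodgeConjecture-24833`; road M6 → F5 → the dyadic chain of organ (D-UNR)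
`stub_DyUnramCore`, LEVEL TWO, site (L2-1): ★ RIGID-2 §3 `levelTwo_conj_cornerUnipotent_of_two_deep` ∕ `levelTwo_conj_upperUnipotent_one_of_two_deep`
(`UnitaryThreeBoundaryRigidityLevelTwo` :291 ∕ :328) carry `h2 : v 2 = 1` ONLY to call ★ (A2); part 1∕4 (`…HeisenbergClassesOfTrace`) proves (A2) with `h2` deleted (the θ-device
on ★ `UnramifiedLocalConjDatum.trace`), so both RIGID-2 heads hold with `h2` DELETED: this file is ★ §3 VERBATIM with the two (A2) calls re-sourced (names suffixed `_of_trace`);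
★ §1∕§2∕§4 are 2-free and imported.  HONEST LABEL: HC_CM is proved only modulo the 7 printed citations (2 remaining named inputs: hLiu418 = stmt-HodgeConjecture-24832, h413 =
stmt-HodgeConjecture-24833) until rung 0 closes; elementary matrix algebra over a valued field, count-neutral (zero label movement until the desk prices the `stub_N6nsDyadic` rider).

* **`levelTwo_conj_cornerUnipotent_of_two_deep_of_trace`** (RIGID-2, transvection type, residual norm surjectivity `hN`), **`levelTwo_conj_upperUnipotent_one_of_two_deep_of_trace`**
  (RIGID-2, regular type) — ★'s statements with `(h2 : Valued.v (2 : K) = 1)` DELETED, nothing else.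

## References
* [Rogawski1990] J. D. Rogawski, *Automorphic Representations of Unitary Groups in Three Variables*, Ann. of Math. Stud. 123 (1990): §1.10 p. 9, §3.9 p. 32, Prop. 3.9.1.
* [Tits1979] J. Tits, *Reductive groups over local fields*, Proc. Sympos. Pure Math. 33.1 (1979): §3.3.3 (hyperspecial `K₀`, Cartan decomposition), §3.5 (congruence filtration).
-/

set_option autoImplicit false

open Matrix
open scoped Valued WithZero Matrix MatrixGroups

namespace Literature.NumberTheory.Automorphic.UnitaryGroup

open Literature.NumberTheory.Automorphic Literature.NumberTheory.Automorphic.HermitianLattice Literature.NumberTheory.Automorphic.UnitaryLatticeTree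

variable {K : Type*} [Field K] [Valued K ℤᵐ⁰]

/-! ## RIGID-2: the two boundary strata, `h2` deleted -/

/-- **HEAD (B-tv) — RIGID-2, TRANSVECTION TYPE.** For `γ` `2`-deep at `𝒪³` and a `γ`-fixed hyperspecial vertex `g·𝒪³` whose local element `x = g⁻¹ γ g ∈ K₀` is residually a
transvection (`(x̄ − 1)² = 0 ≠ x̄ − 1`), `x` is `K₀`-conjugate mod `ϖ²` to `n(t₀)` for every skew unit `t₀` — ONE level-2 class on the whole transvection stratum (given
residual norm surjectivity `hN`).  ★ minus `h2`. [cite: Rogawski1990, §3.9 p. 32] [cite: Tits1979, §3.3.3] -/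
theorem levelTwo_conj_cornerUnipotent_of_two_deep_of_trace {σ : K →+* K} {ϖ : K} (hd : UnramifiedLocalConjDatum σ ϖ)
    (hN : ∀ u : K, σ u = u → Valued.v u = 1 → ∃ z : K, Valued.v (z * σ z - u) < 1)
    {γ g x : GL (Fin 3) K} (hγU : γ ∈ unitaryGroupOfForm σ ((StdForm.antidiagonal 3).over K))
    (hγ2 : IsIntMatrix ((ϖ ^ 2)⁻¹ • ((γ : Matrix (Fin 3) (Fin 3) K) - 1)))
    (hgU : g ∈ unitaryGroupOfForm σ ((StdForm.antidiagonal 3).over K)) (hxg : x = g⁻¹ * γ * g) (hxint : IsIntMatrix (x : Matrix (Fin 3) (Fin 3) K))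
    (hx1 : ¬ IsIntMatrix (ϖ⁻¹ • ((x : Matrix (Fin 3) (Fin 3) K) - 1))) (hx2 : IsIntMatrix (ϖ⁻¹ • ((x : Matrix (Fin 3) (Fin 3) K) - 1) ^ 2))
    {t₀ : K} (ht₀ : σ t₀ + t₀ = 0) (ht₀v : Valued.v t₀ = 1) :
    ∃ k : GL (Fin 3) K, k ∈ unitaryGroupOfForm σ ((StdForm.antidiagonal 3).over K) ∧ IsIntMatrix (k : Matrix (Fin 3) (Fin 3) K) ∧
      IsIntMatrix ((k⁻¹ : GL (Fin 3) K) : Matrix (Fin 3) (Fin 3) K) ∧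
      IsIntMatrix ((ϖ ^ 2)⁻¹ • (((k * x * k⁻¹ : GL (Fin 3) K) : Matrix (Fin 3) (Fin 3) K) - !![1, 0, t₀; 0, 1, 0; 0, 0, 1])) := by
  have hxU : x ∈ unitaryGroupOfForm σ ((StdForm.antidiagonal 3).over K) := by rw [hxg]; exact mul_mem (mul_mem (inv_mem hgU) hγU) hgU
  obtain ⟨k, hkU, hki, hki', α, β, hα1, hβ1, hk⟩ := exists_levelTwo_conj_near_heisenberg_of_two_deep hd hγU hγ2 hgU hxg hxint
  have hyU : k * x * k⁻¹ ∈ unitaryGroupOfForm σ ((StdForm.antidiagonal 3).over K) := mul_mem (mul_mem hkU hxU) (inv_mem hkU)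
  -- residual type transport along `k`
  have hy2 : IsIntMatrix (ϖ⁻¹ • (((k * x * k⁻¹ : GL (Fin 3) K) : Matrix (Fin 3) (Fin 3) K) - 1) ^ 2) := by
    rw [Units.val_mul, Units.val_mul]; exact isIntMatrix_smul_conj_sub_one_sq _ hki hki' (Units.mul_inv k) (Units.inv_mul k) hx2
  have hy1 : ¬ IsIntMatrix (ϖ⁻¹ • (((k * x * k⁻¹ : GL (Fin 3) K) : Matrix (Fin 3) (Fin 3) K) - 1)) := fun h => hx1 (by
    have h' := isIntMatrix_smul_conj_sub_one _ hki' hki (Units.inv_mul k) h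
    rwa [Units.val_mul, Units.val_mul, show ((k⁻¹ : GL (Fin 3) K) : Matrix (Fin 3) (Fin 3) K) * ((k : Matrix (Fin 3) (Fin 3) K) *
      (x : Matrix (Fin 3) (Fin 3) K) * ((k⁻¹ : GL (Fin 3) K) : Matrix (Fin 3) (Fin 3) K)) * (k : Matrix (Fin 3) (Fin 3) K) = x by
      rw [← Units.val_mul, ← Units.val_mul, ← Units.val_mul, ← Units.val_mul]; congr 1; group] at h')
  have hα : Valued.v α < 1 := by
    have h := (isIntMatrix_inv_smul_sub_one_sq_iff_of_near_heisenberg hd hα1 hβ1 hk).1 hy2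
    by_contra hα'
    have hα1' : Valued.v α = 1 := le_antisymm hα1 (not_lt.1 hα')
    rw [map_mul, hd.vσ, hα1', one_mul] at h
    exact absurd h (not_le.2 (ϖ_facts hd).2.2.1)
  have hβ : Valued.v β = 1 := v_corner_eq_one_of_near_heisenberg hd hα hβ1 hk hy1
  obtain ⟨k', hk'U, hk'i, hk'i', hc⟩ := levelTwo_conj_cornerUnipotent_of_near_heisenberg_of_trace hd hN hyU hα hβ hk ht₀ ht₀v
  refine ⟨k' * k, mul_mem hk'U hkU, ?_, ?_, ?_⟩
  · rw [Units.val_mul]; exact isIntMatrix_mul hk'i hki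
  · rw [_root_.mul_inv_rev, Units.val_mul]; exact isIntMatrix_mul hki' hk'i'
  · rwa [show k' * k * x * (k' * k)⁻¹ = k' * (k * x * k⁻¹) * k'⁻¹ by group]

/-- **HEAD (B-reg) — RIGID-2, REGULAR TYPE.** For `γ` `2`-deep at `𝒪³` and a `γ`-fixed hyperspecial vertex whose local element `x ∈ K₀` is residually REGULAR unipotent
(`(x̄ − 1)² ≠ 0`), `x` is `K₀`-conjugate mod `ϖ²` to the reference `u(1, b₀)` — ONE level-2 class on the regular stratum (no norm hypothesis).  ★ minus `h2`.
[cite: Rogawski1990, §3.9 Prop. 3.9.1 p. 32] [cite: Tits1979, §3.3.3] -/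
theorem levelTwo_conj_upperUnipotent_one_of_two_deep_of_trace {σ : K →+* K} {ϖ : K} (hd : UnramifiedLocalConjDatum σ ϖ)
    {γ g x : GL (Fin 3) K} (hγU : γ ∈ unitaryGroupOfForm σ ((StdForm.antidiagonal 3).over K))
    (hγ2 : IsIntMatrix ((ϖ ^ 2)⁻¹ • ((γ : Matrix (Fin 3) (Fin 3) K) - 1)))
    (hgU : g ∈ unitaryGroupOfForm σ ((StdForm.antidiagonal 3).over K)) (hxg : x = g⁻¹ * γ * g) (hxint : IsIntMatrix (x : Matrix (Fin 3) (Fin 3) K))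
    (hxreg : ¬ IsIntMatrix (ϖ⁻¹ • ((x : Matrix (Fin 3) (Fin 3) K) - 1) ^ 2))
    {b₀ : K} (hb₀ : b₀ + σ b₀ + 1 = 0) (hb₀v : Valued.v b₀ ≤ 1) :
    ∃ k : GL (Fin 3) K, k ∈ unitaryGroupOfForm σ ((StdForm.antidiagonal 3).over K) ∧ IsIntMatrix (k : Matrix (Fin 3) (Fin 3) K) ∧
      IsIntMatrix ((k⁻¹ : GL (Fin 3) K) : Matrix (Fin 3) (Fin 3) K) ∧
      IsIntMatrix ((ϖ ^ 2)⁻¹ • (((k * x * k⁻¹ : GL (Fin 3) K) : Matrix (Fin 3) (Fin 3) K) - !![1, 1, b₀; 0, 1, -1; 0, 0, 1])) := by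
  have hxU : x ∈ unitaryGroupOfForm σ ((StdForm.antidiagonal 3).over K) := by rw [hxg]; exact mul_mem (mul_mem (inv_mem hgU) hγU) hgU
  obtain ⟨k, hkU, hki, hki', α, β, hα1, hβ1, hk⟩ := exists_levelTwo_conj_near_heisenberg_of_two_deep hd hγU hγ2 hgU hxg hxint
  have hyU : k * x * k⁻¹ ∈ unitaryGroupOfForm σ ((StdForm.antidiagonal 3).over K) := mul_mem (mul_mem hkU hxU) (inv_mem hkU)
  have hyreg : ¬ IsIntMatrix (ϖ⁻¹ • (((k * x * k⁻¹ : GL (Fin 3) K) : Matrix (Fin 3) (Fin 3) K) - 1) ^ 2) := fun h => hxreg (by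
    have h' := isIntMatrix_smul_conj_sub_one_sq _ hki' hki (Units.inv_mul k) (Units.mul_inv k) h
    rwa [Units.val_mul, Units.val_mul, show ((k⁻¹ : GL (Fin 3) K) : Matrix (Fin 3) (Fin 3) K) * ((k : Matrix (Fin 3) (Fin 3) K) *
      (x : Matrix (Fin 3) (Fin 3) K) * ((k⁻¹ : GL (Fin 3) K) : Matrix (Fin 3) (Fin 3) K)) * (k : Matrix (Fin 3) (Fin 3) K) = x by
      rw [← Units.val_mul, ← Units.val_mul, ← Units.val_mul, ← Units.val_mul]; congr 1; group] at h')
  have hα : Valued.v α = 1 := by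
    by_contra hα'
    have hαϖ := v_le_ϖ_of_lt_one hd (lt_of_le_of_ne hα1 hα')
    exact hyreg ((isIntMatrix_inv_smul_sub_one_sq_iff_of_near_heisenberg hd hα1 hβ1 hk).2
      (v_mul_le_of_le_of_le_one hαϖ (by rw [hd.vσ]; exact hα1)))
  obtain ⟨k', hk'U, hk'i, hk'i', hc⟩ := levelTwo_conj_upperUnipotent_one_of_near_heisenberg_of_trace hd hyU hα hβ1 hk hb₀ hb₀v
  refine ⟨k' * k, mul_mem hk'U hkU, ?_, ?_, ?_⟩
  · rw [Units.val_mul]; exact isIntMatrix_mul hk'i hki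
  · rw [_root_.mul_inv_rev, Units.val_mul]; exact isIntMatrix_mul hki' hk'i'
  · rwa [show k' * k * x * (k' * k)⁻¹ = k' * (k * x * k⁻¹) * k'⁻¹ by group]


end Literature.NumberTheory.Automorphic.UnitaryGroup
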